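import Mathlib
import HarnessLib
import Literature.Probability.MarkovChains.SingleSiteUpdateDomination
import Literature.Probability.MarkovChains.IsingGlauberMonotone

/-!
# The censoring inequality (Peres–Winkler; Levin–Peres–Wilmer Theorem 22.20, Lemma 22.22)

HONEST FRAMING: exact (Metropolis-corrected) sampling algorithms for lattice gauge theory; figures
of merit are autocorrelation/cost numbers at stated couplings and volumes; no continuum-physics claim.

Conventions of `GlauberDynamics.lean` (`glauberSiteLaw π σ v` = `P_v(σ,·)`), `TotalVariation.lean`
(`tvDist`, `stepLaw`), `StochasticDomination.lean` (`StochDom μ ν` = `μ ⪯ ν`, `IsMonotoneChain`),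
`SingleSiteUpdateDomination.lean` (Lemmas 22.21, 22.24).  Configurations `σ : V → S`, `S` a finite
chain, coordinate-wise order, `π > 0` on all of `S^V` (a "monotone spin system" = every `P_v` is a
monotone chain); the law obtained from `μ₀` by successive updates at the sites of a list
`L = [v₁, …, v_m]` is `L.foldl (μ ↦ v ↦ μP_v) μ₀`.  Source: D. A. Levin, Y. Peres (with E. L. Wilmer),
*Markov Chains and Mixing Times*, 2nd ed., AMS 2017 [LevinPeres2017], §22.6 Theorem 22.20 and
Lemma 22.22 with the "Proof of Theorem 22.20" (pp. 314–316; read from the author-hosted copy); the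
theorem is due to Y. Peres and P. Winkler (as credited in the book's Notes to Chapter 22).  Everything is
PROVED (0 named facts).

* **LEMMA 22.22** `LevinPeres2017_lemma_22_22` — on any finite (pre)ordered set with `π > 0`: if `μ/π`
  is increasing and `μ ⪯ ν` then `‖μ − π‖_TV ≤ ‖ν − π‖_TV` (the set `A = {μ ≥ π}` is an up-set, so
  `‖μ − π‖ = μ(A) − π(A) ≤ ν(A) − π(A) ≤ ‖ν − π‖`) [cite: LevinPeres2017, §22.6 Lemma 22.22];
* `foldl_update_invariant` — along any update sequence `L` and any SUBSEQUENCE `L'` of it, started from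
  laws `μ ⪯ ν` with `μ/π` increasing: the final laws satisfy `μ_L/π` increasing and `μ_L ⪯ ν_{L'}`
  (induction on the subsequence: a shared update preserves `⪯` by Proposition 22.7 and monotonicity of
  the ratio by Lemma 22.21; a censored update has `μP_v ⪯ μ` by Lemma 22.24)
  [cite: LevinPeres2017, §22.6, Proof of Theorem 22.20 (p. 316)];
* `LevinPeres2017_thm_22_20_ising` — the Ising heat-bath instance (`β ≥ 0`, start from all-plus)
  [cite: LevinPeres2017, §22.6 Thm 22.20 with Example 22.9 and §22.6.1];
* **THEOREM 22.20 (censoring inequality)** `LevinPeres2017_thm_22_20` — for a monotone spin system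
  with maximal state `⊤`, if `μ` results from updates at `v₁, …, v_m` started from `⊤` and `ν` from
  updates at a subsequence `v_{i₁}, …, v_{i_k}`, also started from `⊤`, then `μ ⪯ ν` and
  `‖μ − π‖_TV ≤ ‖ν − π‖_TV` — "censoring updates never decreases the distance to stationarity"
  [cite: LevinPeres2017, §22.6 Thm 22.20].

`TODO(general form)`: sub-systems `X ⊊ S^V` with a maximal state (the book's generality) are not
covered; here `X = S^V` with its top configuration.

Context (cell pub-lqcd, venture LatticeQCDFlow): for heat-bath samplers of monotone (ferromagnetic)
lattice systems started from the ordered configuration, dropping site updates from a sweep schedule can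
only slow convergence in total variation — the comparison principle behind systematic-sweep vs
partial-sweep arguments and block-dynamics upper bounds.
-/

namespace Literature.Probability.MarkovChains

open Finset Function

/-! ## Lemma 22.22 (any finite preorder) -/

section Lemma2222

variable {X : Type*} [Fintype X] [DecidableEq X] [Preorder X]

/-- **LEMMA 22.22.**  Let `π > 0` and let `μ, ν, π` be probability vectors.  If `μ/π` is increasing
and `μ ⪯ ν`, then `‖μ − π‖_TV ≤ ‖ν − π‖_TV`. [cite: LevinPeres2017, §22.6 Lemma 22.22] -/
theorem LevinPeres2017_lemma_22_22 {π μ ν : X → ℝ} (hπ : ∀ x, 0 < π x) (hπ1 : ∑ x, π x = 1)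
    (hμ1 : ∑ x, μ x = 1) (hν1 : ∑ x, ν x = 1) (hr : Monotone (fun x => μ x / π x))
    (hdom : StochDom μ ν) : tvDist μ π ≤ tvDist ν π := by
  classical
  -- `A = {x : π x ≤ μ x}` is an up-set
  set U : Set X := {x | π x ≤ μ x} with hU
  have hUup : IsUpperSet U := by
    intro a b hab ha
    have ha' : 1 ≤ μ a / π a := by rw [le_div_iff₀ (hπ a), one_mul]; exact ha
    have hb' : 1 ≤ μ b / π b := ha'.trans (hr hab)
    show π b ≤ μ b
    rwa [le_div_iff₀ (hπ b), one_mul] at hb'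
  -- `‖μ − π‖ = μ(A) − π(A)`
  have h1 : tvDist μ π = ∑ x ∈ univ.filter (fun x => π x ≤ μ x), μ x
      - ∑ x ∈ univ.filter (fun x => π x ≤ μ x), π x := by
    rw [tvDist_eq_sum_filter (by rw [hμ1, hπ1]), sum_sub_distrib]
  -- `μ(A) ≤ ν(A)` by domination
  have h2 := hdom.sum_le_of_isUpperSet hUup
  have e : univ.filter (· ∈ U) = univ.filter (fun x => π x ≤ μ x) := by
    ext x; simp [hU]
  rw [e] at h2
  -- `ν(A) − π(A) ≤ ‖ν − π‖`
  have h3 := sub_sum_le_tvDist (μ := ν) (ν := π) (by rw [hν1, hπ1])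
    (univ.filter (fun x => π x ≤ μ x))
  linarith

end Lemma2222

/-! ## Theorem 22.20 -/

section Censoring

variable {V S : Type*} [Fintype V] [DecidableEq V] [Fintype S] [DecidableEq S] [LinearOrder S]

/-! Below, `P_v` is the kernel `fun x y => glauberSiteLaw π x v y` and the law after successive updates at the
sites of a list `L` from `μ` is `L.foldl (fun m v => stepLaw (fun x y => glauberSiteLaw π x v y) m) μ`. -/

variable {π : (V → S) → ℝ}

omit [LinearOrder S] in
/-- Updates preserve total mass. [cite: LevinPeres2017, §22.6 (each `P_v` is a transition matrix)] -/
theorem sum_foldl_update (hπ : ∀ x, 0 < π x) (L : List V) :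
    ∀ μ : (V → S) → ℝ, ∑ σ, (List.foldl (fun (m : (V → S) → ℝ) (v : V) => stepLaw (fun x y : V → S => glauberSiteLaw π x v y) m) μ L) σ = ∑ σ, μ σ := by
  induction L with
  | nil => intro μ; rfl
  | cons v L ih =>
      intro μ
      rw [List.foldl_cons, ih, sum_stepLaw (siteLaw_isRowStochastic hπ v)]

/-- **The induction of the proof of Theorem 22.20.**  Let every `P_v` be monotone.  If `μ/π` is
increasing and `μ ⪯ ν`, then after updating `μ` along `L` and `ν` along a subsequence `L'` of `L`,
the ratio `μ_L/π` is still increasing and `μ_L ⪯ ν_{L'}`: a shared update keeps `⪯` (Prop. 22.7) and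
the monotone ratio (Lemma 22.21); a censored one has `μP_v ⪯ μ` (Lemma 22.24).
[cite: LevinPeres2017, §22.6, Proof of Theorem 22.20 (p. 316)] -/
theorem foldl_update_invariant (hπ : ∀ x, 0 < π x) (hmono : ∀ v, IsMonotoneChain (fun x y : V → S => glauberSiteLaw π x v y))
    {L L' : List V} (hL : L'.Sublist L) :
    ∀ μ ν : (V → S) → ℝ, Monotone (fun σ => μ σ / π σ) → StochDom μ ν →
      Monotone (fun σ => (List.foldl (fun (m : (V → S) → ℝ) (v : V) => stepLaw (fun x y : V → S => glauberSiteLaw π x v y) m) μ L) σ / π σ) ∧ StochDom (List.foldl (fun (m : (V → S) → ℝ) (v : V) => stepLaw (fun x y : V → S => glauberSiteLaw π x v y) m) μ L) (List.foldl (fun (m : (V → S) → ℝ) (v : V) => stepLaw (fun x y : V → S => glauberSiteLaw π x v y) m) ν L') := by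
  induction hL with
  | slnil => intro μ ν hr hdom; exact ⟨hr, hdom⟩
  | @cons L' L v h ih =>
      -- the update at `v` is censored in `L'`
      intro μ ν hr hdom
      rw [List.foldl_cons]
      exact ih _ _ (LevinPeres2017_lemma_22_21 hπ (hmono v) hr)
        (fun f hf => (LevinPeres2017_lemma_22_24 hπ hr v f hf).trans (hdom f hf))
  | @cons_cons L' L v h ih =>
      -- both sequences update at `v`
      intro μ ν hr hdom
      rw [List.foldl_cons, List.foldl_cons]
      exact ih _ _ (LevinPeres2017_lemma_22_21 hπ (hmono v) hr) ((hmono v).stochDom_stepLaw hdom)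

omit [DecidableEq V] [Fintype S] in
/-- The point mass at the top configuration has increasing likelihood ratio `δ_⊤/π`.
[cite: LevinPeres2017, §22.6, Proof of Theorem 22.20 ("Let `μ₀` be the distribution concentrated at
the top configuration")] -/
theorem monotone_single_top_div (hπ : ∀ x, 0 < π x) {top : V → S} (htop : ∀ σ, σ ≤ top) :
    Monotone (fun σ => (Pi.single top (1 : ℝ) : (V → S) → ℝ) σ / π σ) := by
  intro σ τ hστ
  by_cases hσ : σ = top
  · have hτ : τ = top := le_antisymm (htop τ) (hσ ▸ hστ)
    subst hσ; subst hτ; exact le_rfl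
  · simp only [Pi.single_apply, if_neg hσ, zero_div]
    split_ifs
    · exact div_nonneg zero_le_one (hπ τ).le
    · rw [zero_div]

/-- **THEOREM 22.20 (censoring inequality).**  Let `π > 0` be a monotone spin system on `S^V`
(every single-site update `P_v` monotone) with top configuration `⊤`.  Let `μ` be the distribution
resulting from updates at sites `v₁, …, v_m`, starting from `⊤`, and `ν` the distribution resulting
from updates at a subsequence `v_{i₁}, …, v_{i_k}`, also started from `⊤`.  Then `μ ⪯ ν` and
`‖μ − π‖_TV ≤ ‖ν − π‖_TV`. [cite: LevinPeres2017, §22.6 Thm 22.20] -/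
theorem LevinPeres2017_thm_22_20 (hπ : ∀ x, 0 < π x) (hπ1 : ∑ x, π x = 1)
    (hmono : ∀ v, IsMonotoneChain (fun x y : V → S => glauberSiteLaw π x v y)) {top : V → S} (htop : ∀ σ, σ ≤ top)
    {L L' : List V} (hL : L'.Sublist L) :
    StochDom (List.foldl (fun (m : (V → S) → ℝ) (v : V) => stepLaw (fun x y : V → S => glauberSiteLaw π x v y) m) (Pi.single top 1) L) (List.foldl (fun (m : (V → S) → ℝ) (v : V) => stepLaw (fun x y : V → S => glauberSiteLaw π x v y) m) (Pi.single top 1) L') ∧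
      tvDist (List.foldl (fun (m : (V → S) → ℝ) (v : V) => stepLaw (fun x y : V → S => glauberSiteLaw π x v y) m) (Pi.single top 1) L) π ≤ tvDist (List.foldl (fun (m : (V → S) → ℝ) (v : V) => stepLaw (fun x y : V → S => glauberSiteLaw π x v y) m) (Pi.single top 1) L') π := by
  obtain ⟨hr, hdom⟩ := foldl_update_invariant hπ hmono hL (Pi.single top 1) (Pi.single top 1)
    (monotone_single_top_div hπ htop) (fun _ _ => le_rfl)
  refine ⟨hdom, ?_⟩
  have hδ1 : ∑ σ, (Pi.single top (1 : ℝ) : (V → S) → ℝ) σ = 1 := by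
    simp [Pi.single_apply]
  exact LevinPeres2017_lemma_22_22 hπ hπ1 ((sum_foldl_update hπ L _).trans hδ1)
    ((sum_foldl_update hπ L' _).trans hδ1) hr hdom

end Censoring

/-! ## Application: heat-bath sweeps of the ferromagnetic Ising model -/

section Ising

variable {V : Type*} [Fintype V] [DecidableEq V] {G : SimpleGraph V} [DecidableRel G.Adj]

/-- **Censoring inequality for the Ising heat-bath dynamics.**  For the ferromagnetic Ising model
(`β ≥ 0`) on a finite graph, let `μ` be the law after heat-bath updates at the sites `v₁, …, v_m`
started from the all-plus configuration, and `ν` the law after updates at a subsequence of them, also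
from all-plus.  Then `μ ⪯ ν` and `‖μ − π_β‖_TV ≤ ‖ν − π_β‖_TV` (Theorem 22.20 for the monotone spin
system of Example 22.9). [cite: LevinPeres2017, §22.6 Thm 22.20 with §22.3.1 Example 22.9 (the Ising
Glauber chain is a monotone spin system) and §22.6.1 (application to the Ising model)] -/
theorem LevinPeres2017_thm_22_20_ising {β : ℝ} (hβ : 0 ≤ β) {L L' : List V} (hL : L'.Sublist L) :
    StochDom
        (L.foldl (fun (m : (V → ℤˣ) → ℝ) (v : V) =>
          stepLaw (fun x y : V → ℤˣ => glauberSiteLaw (gibbsLaw G β) x v y) m) (Pi.single (fun _ => 1) 1))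
        (L'.foldl (fun (m : (V → ℤˣ) → ℝ) (v : V) =>
          stepLaw (fun x y : V → ℤˣ => glauberSiteLaw (gibbsLaw G β) x v y) m) (Pi.single (fun _ => 1) 1)) ∧
      tvDist (L.foldl (fun (m : (V → ℤˣ) → ℝ) (v : V) =>
          stepLaw (fun x y : V → ℤˣ => glauberSiteLaw (gibbsLaw G β) x v y) m) (Pi.single (fun _ => 1) 1))
          (gibbsLaw G β)
        ≤ tvDist (L'.foldl (fun (m : (V → ℤˣ) → ℝ) (v : V) =>
          stepLaw (fun x y : V → ℤˣ => glauberSiteLaw (gibbsLaw G β) x v y) m) (Pi.single (fun _ => 1) 1))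
          (gibbsLaw G β) :=
  LevinPeres2017_thm_22_20 (gibbsLaw_pos β) (sum_gibbsLaw β)
    (fun v => LevinPeres2017_example_22_9 (G := G) hβ v)
    (top := fun _ => 1) (fun σ => (spinLE_iff_le σ _).mp (spinLE_top σ)) hL

end Ising

end Literature.Probability.MarkovChains
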